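import Summits.QuantumFields.YangMills.Theorems.BalabanUVNodesPortS1FlatLetter

/-!
# NODE O port PT-A — AT THE FLAT BACKGROUND THE DIMENSION MATCH OF `…PortS1ZkGraph` HOLDS: `LQ̃(1)` is 𝔰𝔲(2)-VALUED (`= Q₁(1) ∘ fluctMat`, signed covariant sums of 𝔰𝔲(2) matrices),
# so `ker LQ̃(1)` is the full coordinate kernel of `recordLQtMat 1`; with the letter at the flat background (`recordB0BlockInvertible_one`) `recordLQtMat 1` is onto, and rank–nullity gives
# `finrank (fluctKer 1) = #NonB0Idx` — the displayed `σ` of the Z-bridge exists at `Vk = 1`, where the bridge then needs positivity only (`recordZkkCan_eq_recordZkkLoc_one`)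

Cell `ym-nodeO-ideate`, porter seat `ymgap-nodeO-port-PTA-1` (gen 4); `--supports stmt-QuantumFields-27930` (helper; completes the base-point package `…FlatLQt` ∕ `…FlatLetter`).  [I] = [Balaban1987RG1].
* §1 𝔰𝔲(2)-valuedness: `stepFactor_mem_unitaryGroup`, `covWalkSum_mem_lieSU`, `covLinAvg_mem_lieSU`, ★ `recordLQt_one_mem_lieSU`; `eq_zero_of_mem_lieSU_of_su2Coord` (the three real coordinates determine an
  𝔰𝔲(2) matrix).
* §2 ★ `recordLQtMat_one_mulVec_eq_zero_iff` (coordinate kernel = `fluctKer 1`); `recordLQtMat_one_surjective` (under the letter, automatic at flat); ★★ `finrank_fluctKer_one`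
  (`= Fintype.card (NonB0Idx F k K)`), `nonempty_fluctKer_one_equiv`; ★★ `recordZkkCan_eq_recordZkkLoc_one` (the Z-bridge at the flat background from positivity alone).

HONEST FRAMING.  Linear algebra at the flat base point; NOTHING of Bałaban asserted∕ported∕discharged; positivity of the preconditioned matrix is still DISPLAYED; 27930 OPEN; K0⁷∕K-Ax OPEN; NODE O
0∕1; COUNT 8∕28 · K 1∕4 UNMOVED; finite `𝕋⁴_{L^K}` at fixed ε — NOT continuum ∕ OS ∕ Clay; **the Yang–Mills mass gap is NOT proved by any of this.**  No `sorry`, no `def`, no `instance`.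
-/

noncomputable section

open scoped BigOperators Matrix.Norms.L2Operator Topology

namespace Summit.QuantumFields.YangMills.Theorems.BalabanUVNodesPortS1

open Summit.QuantumFields.YangMills.Theorems.K0RecordFormatNames
open Literature.MathematicalPhysics.QuantumFieldTheory.Balaban1983to89
open Literature.MathematicalPhysics.QuantumFieldTheory.Balaban1983to89.Node00
open Literature.MathematicalPhysics.QuantumFieldTheory.Balaban1983to89.T4Continuum (T4Family)
open Literature.MathematicalPhysics.QuantumFieldTheory.Balaban1983to89.BlockAveraging (Idx)
open Literature.MathematicalPhysics.QuantumFieldTheory.Balaban1983to89.BlockAveragingEMLLinearised (stepFactor)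
open Literature.MathematicalPhysics.QuantumFieldTheory.Balaban1983to89.BlockAveragingEMLLinearisedBackground (covLinAvg covWalkSum covStep)
open Literature.MathematicalPhysics.QuantumFieldTheory.Balaban1983to89.T4AdjointCovarianceUnitary (lieSU mem_lieSU_iff conj_mem_lieSU)
open _root_.Matrix

variable (F : T4Family)

/-! ## §1  `LQ̃(1)` is 𝔰𝔲(2)-valued -/

/-- The step factors of a holonomy are unitary matrices. [folklore] -/
theorem stepFactor_mem_unitaryGroup {K k : ℕ} (U₀ : GaugeField (F.P K) k (SU 2)) (s : T4Continuum.LStep (F.P K) k) :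
    stepFactor U₀ s ∈ Matrix.unitaryGroup (Fin 2) ℂ := by
  unfold stepFactor
  split_ifs
  · exact (Matrix.mem_specialUnitaryGroup_iff.mp (U₀ s.bond).2).1
  · exact Unitary.star_mem (Matrix.mem_specialUnitaryGroup_iff.mp (U₀ s.bond).2).1

/-- **Covariant signed sums of an 𝔰𝔲(2)-valued bond field are 𝔰𝔲(2)-valued** (sums, negatives and unitary conjugates of 𝔰𝔲(2) matrices). [cite: Balaban1985Averaging, (58) p.27 (bookkeeping)] -/
theorem covWalkSum_mem_lieSU {K k : ℕ} (U₀ : GaugeField (F.P K) k (SU 2)) {Y : PBond (F.P K) k → MatA 2} (hY : ∀ b, Y b ∈ lieSU (Fin 2)) :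
    ∀ γ : List (T4Continuum.LStep (F.P K) k), covWalkSum U₀ Y γ ∈ lieSU (Fin 2)
  | [] => by rw [BlockAveragingEMLLinearisedBackground.covWalkSum_nil]; exact Submodule.zero_mem _
  | s :: γ => by
    rw [BlockAveragingEMLLinearisedBackground.covWalkSum_cons]
    refine Submodule.add_mem _ ?_ (conj_mem_lieSU (covWalkSum_mem_lieSU U₀ hY γ) ⟨stepFactor U₀ s, stepFactor_mem_unitaryGroup F U₀ s⟩)
    unfold covStep
    split_ifs
    · exact hY _
    · exact Submodule.neg_mem _ (conj_mem_lieSU (hY _) ⟨stepFactor U₀ s, stepFactor_mem_unitaryGroup F U₀ s⟩)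

/-- A complex multiple by a REAL scalar of an 𝔰𝔲(2) matrix is in 𝔰𝔲(2). [folklore] -/
theorem real_smul_mem_lieSU {X : MatA 2} (hX : X ∈ lieSU (Fin 2)) (r : ℝ) : ((r : ℂ)) • X ∈ lieSU (Fin 2) := by
  rw [Complex.coe_smul]
  exact Submodule.smul_mem _ r hX

/-- **`Q₁(U₀)(Y)(c)` is 𝔰𝔲(2)-valued for 𝔰𝔲(2)-valued `Y`.** [cite: Balaban1985Averaging, (124) p.36 (bookkeeping)] -/
theorem covLinAvg_mem_lieSU {K k : ℕ} (U₀ : GaugeField (F.P K) k (SU 2)) {Y : PBond (F.P K) k → MatA 2} (hY : ∀ b, Y b ∈ lieSU (Fin 2)) (c : PBond (F.P K) (k + 1)) :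
    covLinAvg U₀ Y c ∈ lieSU (Fin 2) := by
  rw [covLinAvg]
  refine Submodule.add_mem _ ?_ (covWalkSum_mem_lieSU F U₀ hY _)
  have hcast : ((Fintype.card (Idx (F.P K)) : ℂ))⁻¹ = ((((Fintype.card (Idx (F.P K)) : ℝ))⁻¹ : ℝ) : ℂ) := by
    rw [Complex.ofReal_inv, Complex.ofReal_natCast]
  rw [hcast]
  exact real_smul_mem_lieSU (Submodule.sum_mem _ fun i _ => covWalkSum_mem_lieSU F U₀ hY _) _

/-- ★ **`LQ̃(1)` IS 𝔰𝔲(2)-VALUED**: `recordLQt F k K 1 x c ∈ 𝔰𝔲(2)` for every coordinate vector `x` and coarse bond `c` (`= Q₁(1)(fluctMat x)(c)`, `…FlatLQt`). [cite: Balaban1987RG1, p.267 (bookkeeping)] -/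
theorem recordLQt_one_mem_lieSU (k K : ℕ) (x : FluctIdx F k K → ℝ) (c : PBond (F.P K) (k + 1)) :
    recordLQt F k K 1 x c ∈ lieSU (Fin 2) := by
  rw [(differentiableAt_recordQt_one_and_recordLQt_one_apply F k K).2 x c]
  exact covLinAvg_mem_lieSU F 1 (fun b => fluctMat_mem_lieSU F k K x b) c

/-- **The three real coordinates determine an 𝔰𝔲(2) matrix**: `M ∈ 𝔰𝔲(2)`, `su2Coord M = 0 ⟹ M = 0`. [folklore] -/
theorem eq_zero_of_mem_lieSU_of_su2Coord {M : MatA 2} (hM : M ∈ lieSU (Fin 2)) (h : ∀ j, su2Coord M j = 0) : M = 0 := by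
  obtain ⟨hstar, htr⟩ := mem_lieSU_iff.mp hM
  have h0 := h 0; have h1 := h 1; have h2 := h 2
  simp only [su2Coord, Matrix.cons_val_zero, Matrix.cons_val_one, Matrix.cons_val] at h0 h1 h2
  have hs : ∀ i j, star (M j i) = -M i j := fun i j => by
    have := congrFun (congrFun hstar i) j
    simpa [Matrix.star_apply] using this
  rw [Matrix.trace, Fin.sum_univ_two] at htr
  have h01 : M 0 1 = 0 := Complex.ext (by simpa using h1) (by simpa using h0)
  have h00re : (M 0 0).re = 0 := by
    have := congrArg Complex.re (hs 0 0)
    simp at this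
    linarith
  have h00 : M 0 0 = 0 := Complex.ext (by simpa using h00re) (by simpa using h2)
  have h11 : M 1 1 = 0 := by
    have : M 1 1 = -M 0 0 := eq_neg_of_add_eq_zero_right htr
    rw [this, h00, neg_zero]
  have h10 : M 1 0 = 0 := by
    have := hs 0 1
    rw [h01, neg_zero, star_eq_zero] at this
    exact this
  ext i j
  fin_cases i <;> fin_cases j <;> simp [h00, h01, h10, h11]

/-! ## §2  The coordinate kernel, the rank, the dimension match, the bridge at the flat background -/

/-- ★ **Coordinate kernel = `fluctKer`** at the flat background: `recordLQtMat 1 *ᵥ x = 0 ↔ x ∈ fluctKer 1` (the real matrix reads `su2Coord ∘ LQ̃(1)`, and `LQ̃(1)` is 𝔰𝔲(2)-valued).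
[cite: Balaban1987RG1, p.267–268 (bookkeeping)] -/
theorem recordLQtMat_one_mulVec_eq_zero_iff (k K : ℕ) (x : FluctIdx F k K → ℝ) :
    recordLQtMat F k K 1 *ᵥ x = 0 ↔ x ∈ fluctKer F k K 1 := by
  rw [fluctKer, LinearMap.mem_ker, ContinuousLinearMap.coe_coe]
  constructor
  · intro h
    funext c
    refine eq_zero_of_mem_lieSU_of_su2Coord (recordLQt_one_mem_lieSU F k K x c) fun j => ?_
    have := congrFun h (c, j)
    rwa [recordLQtMat_mulVec] at this
  · intro h
    funext cj
    rw [recordLQtMat_mulVec, h]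
    obtain ⟨c, j⟩ := cj
    fin_cases j <;> simp [su2Coord]

open Classical in
/-- **Under the letter the coordinate matrix of `LQ̃` is onto** (lift a coarse vector through `A₁⁻¹` on the central-bond coordinates). [cite: Balaban1987RG1, p.267 («LQ̃h = I»)] -/
theorem recordLQtMat_mulVec_surjective (k K : ℕ) (hk : k + 1 ≤ (F.P K).m + (F.P K).K) (Vk : GaugeField (F.P K) k (SU 2)) (hA : RecordB0BlockInvertible F k K Vk) :
    Function.Surjective (recordLQtMat F k K Vk).mulVec := by
  intro y
  set e : CoarseIdx F k K ⊕ NonB0Idx F k K ≃ FluctIdx F k K := Equiv.ofBijective _ (blkToFluct_bijective F k K hk) with he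
  refine ⟨Sum.elim ((recordLQtB0 F k K Vk)⁻¹ *ᵥ y) 0 ∘ e.symm, ?_⟩
  have h1 : recordLQtMat F k K Vk *ᵥ (Sum.elim ((recordLQtB0 F k K Vk)⁻¹ *ᵥ y) 0 ∘ ⇑e.symm) =
      (recordLQtMat F k K Vk).submatrix _root_.id ⇑e *ᵥ Sum.elim ((recordLQtB0 F k K Vk)⁻¹ *ᵥ y) 0 := by
    rw [Matrix.submatrix_mulVec_equiv]; rfl
  have hMblk : recordLQtBlk F k K Vk = (recordLQtMat F k K Vk).submatrix _root_.id ⇑e := recordLQtBlk_eq_submatrix F k K Vk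
  rw [h1, ← hMblk, recordLQtBlk, Matrix.fromCols_mulVec_sumElim, Matrix.mulVec_zero, add_zero, Matrix.mulVec_mulVec,
    Matrix.mul_nonsing_inv _ hA, Matrix.one_mulVec]

open Classical in
/-- ★★ **THE DIMENSION MATCH AT THE FLAT BACKGROUND**: `finrank (fluctKer 1) = #NonB0Idx` (rank–nullity for the onto coordinate matrix whose kernel is `fluctKer 1`, and
`#FluctIdx = #CoarseIdx + #NonB0Idx` along `blkToFluct`). [cite: Balaban1987RG1, p.267–268] -/
theorem finrank_fluctKer_one (k K : ℕ) (hk : k + 1 ≤ (F.P K).m + (F.P K).K) :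
    Module.finrank ℝ (fluctKer F k K (1 : GaugeField (F.P K) k (SU 2))) = Fintype.card (NonB0Idx F k K) := by
  set M := recordLQtMat F k K (1 : GaugeField (F.P K) k (SU 2)) with hM
  have hker : LinearMap.ker M.mulVecLin = fluctKer F k K 1 := by
    ext x
    rw [LinearMap.mem_ker, Matrix.mulVecLin_apply]
    exact recordLQtMat_one_mulVec_eq_zero_iff F k K x
  have hrange : LinearMap.range M.mulVecLin = ⊤ :=
    LinearMap.range_eq_top.mpr (recordLQtMat_mulVec_surjective F k K hk 1 (recordB0BlockInvertible_one F k K hk))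
  have hrn := LinearMap.finrank_range_add_finrank_ker M.mulVecLin
  rw [hrange, finrank_top, hker, Module.finrank_fintype_fun_eq_card, Module.finrank_fintype_fun_eq_card,
    ← Fintype.card_congr (Equiv.ofBijective _ (blkToFluct_bijective F k K hk)), Fintype.card_sum] at hrn
  omega

open Classical in
/-- The displayed `σ` of `…PortS1ZkGraph` EXISTS at the flat background. [cite: Balaban1987RG1, p.267–268 (bookkeeping)] -/
theorem nonempty_fluctKer_one_equiv (k K : ℕ) (hk : k + 1 ≤ (F.P K).m + (F.P K).K) :
    Nonempty (Fin (Module.finrank ℝ (fluctKer F k K (1 : GaugeField (F.P K) k (SU 2)))) ≃ NonB0Idx F k K) :=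
  ⟨(Fintype.equivFinOfCardEq (finrank_fluctKer_one F k K hk).symm).symm⟩

open Classical in
/-- ★★ **THE Z-BRIDGE AT THE FLAT BACKGROUND FROM POSITIVITY ALONE**: `recordZkkCan F k K εbg 1 hopLin = recordZkkLoc F k K εbg 1 hopLin` whenever the preconditioned matrix is positive definite
(the letter and the dimension match are theorems here). [cite: Balaban1987RG1, (1.4) p.260, p.267–268] -/
theorem recordZkkCan_eq_recordZkkLoc_one (k K : ℕ) (hk : k + 1 ≤ (F.P K).m + (F.P K).K) (εbg : ℝ)
    (hopLin : (PBond (F.P K) (k + 1) → MatA 2) →ₗ[ℝ] (FluctIdx F k K → ℝ)) (hP : (recordPreckLoc F k K εbg 1 hopLin).PosDef) :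
    recordZkkCan F k K εbg 1 hopLin = recordZkkLoc F k K εbg 1 hopLin :=
  recordZkkCan_eq_recordZkkLoc F k K εbg 1 hopLin hk (recordB0BlockInvertible_one F k K hk) (Classical.choice (nonempty_fluctKer_one_equiv F k K hk)) hP

end Summit.QuantumFields.YangMills.Theorems.BalabanUVNodesPortS1

end
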